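import Summits.BirchSwinnertonDyer.Rank1Residual.X5.TwoAdicInstancesMultAnchorsS
import Summits.BirchSwinnertonDyer.Rank1Residual.X5.TwoAdicInstances144027d
import Summits.BirchSwinnertonDyer.Rank1Residual.X5.TwoAdicInstancesToolkitC
import Summits.BirchSwinnertonDyer.Rank1Residual.X5.TwoAdicInstancesToolkitD
import Summits.BirchSwinnertonDyer.BirchSwinnertonDyer.Theorems.Rank2ObservatoryRootNumberCert3
import HarnessLib

/-!
# X5 at `p = 2` (cell `bsd-2adic`, seat `bsd-2adic-t42`, GEN 7): SPLIT ANCHORS `198c1`, `342d1` for DOOR (34-GV-mult) — curve data only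

HONEST FRAMING (cell `bsd-2adic`, run/shared/lean/pub/bsd-2adic/, HUMAN RULINGS D-0036 / D-0054): research route; NO door theorem,
nothing displayed, nothing booked; BSD is not proved by any of this. PARTITION: X5@2 multiplicative (K4ᵐ, RESIDUAL-MAP B1·O1;
tranche 1 of the GV-mult habitat) × p = 2 — types-the-object-of (anchor curves for the congruence transport; closes none).
WHAT: the split multiplicative ANCHORS (`2 ∥ N`, `r = 0`, exactly one rational `2`-torsion point, of Greenberg type A or B) that the
tranche-1 classes of HOME/t42/DESIGN-T42-ADDENDUM-8.md need and that are NOT in the mult lane's anchors files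
`X5/TwoAdicInstancesMultAnchors{A,B,C,S}.lean` (one writer per object: those files are imported elsewhere, never edited; planner word
2026-08-27T03:25:10Z (A) «if a class needs a NEW anchor, add it in a t42 anchors file»). Per anchor, DECIDED BY THE KERNEL: minimality,
ellipticity, SPLIT multiplicative reduction at `2`, the conductor (squarefree: coprimality; additive `3`: Rizzo's Table II in the kernel;
additive `ℓ ≥ 5`: `f = 2`), the unique rational `2`-torsion point and its Greenberg type, `2 ∣ #Ẽ(𝔽_ℓ)` at good odd `ℓ`. The anchors'
λ-invariant enters the doors ONLY through the displayed certificate binders `hlanA : λ_an(A) = 1`, `hμanA` of the class files (rows: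
engine-1 GVM-law kit j244761 `mult/step0/GVM-law-p{4,1}.out` (198c1, 342d1: (μ,λ)_an = (0,1), LAW PASS, MU0 YES), engine-2 kit j248630 control rows (OK)) — EVIDENCE, never facts. Emitter: HOME/t42/gen/gen_anchorsfile.py + memberdata.py (port of the mult lane's genlaw5.py member block).
WHAT THIS IS NOT: not a door, not a certificate, not a discharge of anything.

References: [SilvermanAEC2009] VII.1, VII.3.1, VII.5.1, III.1–III.2; [Silverman1994] IV.10.2; [GreenbergLNM1716] §5, Prop. 5.14;
[GreenbergVatsal2000] p. 4 (anchors); [CremonaAlgorithms1997] Table 1 (198c1, 342d1); [Rizzo2003] Table II.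
-/

set_option autoImplicit false

open IsDedekindDomain WeierstrassCurve Literature.NumberTheory.EllipticCurves
  Literature.NumberTheory.EllipticCurves.ModularForms
  Literature.NumberTheory.EllipticCurves.Rank1Residual
  Literature.NumberTheory.EllipticCurves.Rank1Residual.Typed
  Literature.NumberTheory.EllipticCurves.Greenberg1999
  Literature.NumberTheory.EllipticCurves.PolyCert
  Literature.NumberTheory.EllipticCurves.Rank1Residual.X11RankOneCertificates
  Summit.BirchSwinnertonDyer.Rank1Residual.X1.MuPart
  Summit.BirchSwinnertonDyer.Rank1Residual.X1.ParitySqueeze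
  Summit.BirchSwinnertonDyer.Rank1Residual.X5.O1
  Summit.BirchSwinnertonDyer.BirchSwinnertonDyer.Rank2Observatory.RootNumber

open CongruenceSubgroup
open scoped MatrixGroups ModularForm

namespace Summit.BirchSwinnertonDyer.Rank1Residual.X5.Instances

/-! ## Anchor `198c1` (`N = 198`, split at `2`, type B, `x(P) = -9`) -/

/-- Cremona `198c1` = `[1, -1, 1, -65, 209]` (integer model). [cite: CremonaAlgorithms1997, Table 1] -/
abbrev M198c1 : WeierstrassCurve ℤ := ⟨1, -1, 1, -65, 209⟩
/-- `198c1 / ℚ`. [cite: CremonaAlgorithms1997, Table 1] -/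
abbrev c198c1 : WeierstrassCurve ℚ := M198c1.baseChange ℚ
/-- `Δ(198c1) = 2^12·3^3·11`. [cite: CremonaAlgorithms1997, Table 1] -/
theorem M198c1_Δ : M198c1.Δ = 1216512 := by decide
/-- `c₄(198c1)` (`|c₄| = 3^3·5·23`). [cite: CremonaAlgorithms1997, Table 1] -/
theorem M198c1_c₄ : M198c1.c₄ = 3105 := by decide
/-- `c₆(198c1)`. [cite: CremonaAlgorithms1997, Table 1] -/
theorem M198c1_c₆ : M198c1.c₆ = -166833 := by decide
/-- **Rizzo's Table II at `198c1`, evaluated in the kernel on the integer invariants** (`3^3 ∥ c₄`, `3^3 ∥ c₆`, `3^3 ∥ Δ`):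
`v₃(N) = 2` (additive, tamely ramified). [cite: Rizzo2003, Table II (p. 4), column v(N)] -/
theorem condExp_198c1 :
    Rizzo.condExpOfInvariants (M198c1.c₄ : ℚ) (M198c1.c₆ : ℚ) (M198c1.Δ : ℚ) = 2 := by
  rw [M198c1_c₄, M198c1_c₆, M198c1_Δ,
    condExpOfInvariants_intCast _ _ _ 3 3 3 (Or.inr (by decide)) (Or.inr (by decide)) (by decide)]
  decide
/-- `198c1` is an elliptic curve. [cite: CremonaAlgorithms1997, Table 1] -/
instance c198c1_isElliptic : c198c1.IsElliptic := by
  rw [WeierstrassCurve.isElliptic_iff, baseChange_int_Δ, M198c1_Δ]; norm_num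
/-- Cremona's model `198c1` is globally minimal (integer criterion at the primes of `gcd(Δ, c₄) = 27`). [cite: SilvermanAEC2009, VII.1 Remark 1.1] -/
instance c198c1_isGloballyMinimal : c198c1.IsGloballyMinimal := by
  rw [c198c1, baseChange_int_eq]
  refine isGloballyMinimal_of_int_criterion 1 (-1) 1 (-65) 209 (int_criterion_of_primeFactors_gcd (by decide) ?_)
  have hg : (Int.gcd (discOf [1, -1, 1, -65, 209]) (c4Of [1, -1, 1, -65, 209])).primeFactors = {3} := by
    rw [show Int.gcd (discOf [1, -1, 1, -65, 209]) (c4Of [1, -1, 1, -65, 209]) = 27 by decide]; simp [Nat.primeFactors]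
  rw [hg]; decide
/-- **`198c1` is multiplicative at `2`** (`2 ∣ Δ`, `2 ∤ c₄`). [cite: SilvermanAEC2009, VII.5 Prop. 5.1(b)] -/
theorem mult_two_198c1 : Mult c198c1 2 := by
  have hgen : Rat.HeightOneSpectrum.natGenerator
      ((Rat.HeightOneSpectrum.primesEquiv (R := ℤ)).symm ⟨2, Nat.prime_two⟩) = 2 :=
    Literature.NumberTheory.EllipticCurves.Rat.natGenerator_primesEquiv_symm ⟨2, Nat.prime_two⟩
  have hm : c198c1.HasMultiplicativeReductionAt
      ((Rat.HeightOneSpectrum.primesEquiv (R := ℤ)).symm ⟨2, Nat.prime_two⟩) := by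
    refine hasMultiplicativeReductionAt_of_valuation_c₄_eq_one (isIntegralAt_baseChange _ M198c1) ?_ ?_
    · rw [baseChange_int_c₄, Literature.NumberTheory.EllipticCurves.Rat.valuation_intCast_eq_one_iff, hgen,
        M198c1_c₄]; decide
    · rw [baseChange_int_Δ, Literature.NumberTheory.EllipticCurves.Rat.valuation_intCast_lt_one_iff, hgen,
        M198c1_Δ]; decide
  exact (hasMultiplicativeReductionAtPrime_iff_hasMultiplicativeReductionAt_holds c198c1
    ⟨2, Nat.prime_two⟩).mpr hm
/-- `198c1 mod 2`. [folklore] -/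
theorem M198c1_mod_two : M198c1.map (Int.castRingHom (ZMod 2)) = ⟨1, 1, 1, 1, 1⟩ := by
  ext <;> decide
/-- **`198c1` is SPLIT multiplicative at `2`** (the node quadratic has the root `0` in `𝔽₂`). [cite: SilvermanAEC2009, VII.5 Prop. 5.1(b)] -/
theorem split_two_198c1 : c198c1.HasSplitMultiplicativeReductionAtPrime 2 := by
  have hint : integralModelInt c198c1 = M198c1 := integralModelInt_baseChange_int M198c1
  have hΔ : ((2 : ℕ) : ℤ) ∣ (integralModelInt c198c1).Δ := by rw [hint, M198c1_Δ]; decide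
  have hc₄ : ¬ ((2 : ℕ) : ℤ) ∣ (integralModelInt c198c1).c₄ := by rw [hint, M198c1_c₄]; decide
  rw [LocalTorsionMult.hasSplitMultiplicativeReductionAtPrime_iff_splits_integralModelInt c198c1 2 hΔ
    hc₄, hint, M198c1_mod_two]
  dsimp only
  rw [sub_eq_add_neg, ← Polynomial.C_neg]
  exact splits_quadratic_F2_of_root (by decide) 0 (by decide)
/-- `198 = 2 * 3 ^ 2 * 11`: factorization exponents. [folklore] -/
theorem nfact_198c1 (p : ℕ) : (198 : ℕ).factorization p =
    (if 2 = p then 1 else 0) + (if 3 = p then 2 else 0) + (if 11 = p then 1 else 0) := by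
  rw [show (198 : ℕ) = 2 * 3 ^ 2 * 11 by norm_num,
    Nat.factorization_mul (by norm_num) (by norm_num),
    Nat.factorization_mul (by norm_num) (by norm_num),
    Nat.factorization_pow,
    Nat.Prime.factorization (by norm_num : Nat.Prime 2),
    Nat.Prime.factorization (by norm_num : Nat.Prime 3),
    Nat.Prime.factorization (by norm_num : Nat.Prime 11)]
  simp only [Finsupp.coe_add, Finsupp.coe_smul, Pi.add_apply, Pi.smul_apply, Finsupp.single_apply,
    smul_eq_mul]
  split_ifs <;> omega

/-- The conductor exponents of `198c1`: `1` at the multiplicative primes, `2` at the additive ones (at `3`: Rizzo's Table II; at `ℓ ≥ 5`: ATAEC IV.10.2), `0` else.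
[cite: Silverman1994, IV.10.2] [cite: Rizzo2003, Table II (p. 4), column v(N)] -/
theorem factorization_conductorNorm_198c1 (p : ℕ) (hp : p.Prime) :
    (c198c1.conductorNorm ℤ).factorization p = (198 : ℕ).factorization p := by
  have key : (c198c1.conductorNorm ℤ).factorization p =
      c198c1.conductorExponent ((Rat.HeightOneSpectrum.primesEquiv (R := ℤ)).symm ⟨p, hp⟩) :=
    factorization_conductorNorm_primesEquiv_symm c198c1 ⟨p, hp⟩
  rw [key, nfact_198c1]
  by_cases h2 : 2 = p
  · subst h2
    rw [conductorExponent_baseChange_int_eq_one M198c1 hp (by rw [M198c1_Δ]; decide)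
      (by rw [M198c1_c₄]; decide)]
    norm_num
  by_cases h3 : 3 = p
  · subst h3
    rw [show ((Rat.HeightOneSpectrum.primesEquiv (R := ℤ)).symm ⟨3, hp⟩) =
        (Rat.HeightOneSpectrum.primesEquiv (R := ℤ)).symm ⟨3, Nat.prime_three⟩ from rfl,
      conductorExponent_baseChange_int_three M198c1 condExp_198c1]
    norm_num
  by_cases h11 : 11 = p
  · subst h11
    rw [conductorExponent_baseChange_int_eq_one M198c1 hp (by rw [M198c1_Δ]; decide)
      (by rw [M198c1_c₄]; decide)]
    norm_num
  rw [if_neg h2, if_neg h3, if_neg h11]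
  refine conductorExponent_baseChange_int_eq_zero M198c1 hp fun hd ↦ ?_
  rw [M198c1_Δ, show (1216512 : ℤ) = 2 ^ 12 * 3 ^ 3 * 11 by norm_num] at hd
  have hp' : Prime (p : ℤ) := Nat.prime_iff_prime_int.mp hp
  rcases hp'.dvd_or_dvd hd with hd | h_11; swap
  · exact h11 ((Nat.prime_dvd_prime_iff_eq hp (by norm_num : Nat.Prime 11)).mp (by exact_mod_cast h_11)).symm
  rcases hp'.dvd_or_dvd hd with hd | h_3; swap
  · exact h3 ((Nat.prime_dvd_prime_iff_eq hp (by norm_num : Nat.Prime 3)).mp (by exact_mod_cast hp'.dvd_of_dvd_pow h_3)).symm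
  exact h2 ((Nat.prime_dvd_prime_iff_eq hp (by norm_num : Nat.Prime 2)).mp (by exact_mod_cast hp'.dvd_of_dvd_pow hd)).symm

/-- **`N(198c1) = 198`.** [cite: CremonaAlgorithms1997, Table 1] -/
theorem conductorNorm_198c1 : c198c1.conductorNorm ℤ = 198 := by
  refine Nat.eq_of_factorization_eq (c198c1.conductorNorm_pos_holds).ne' (by norm_num) fun p ↦ ?_
  by_cases hp : p.Prime; · exact factorization_conductorNorm_198c1 p hp
  rw [Nat.factorization_eq_zero_of_not_prime _ hp, Nat.factorization_eq_zero_of_not_prime _ hp]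

/-- The coefficients of `198c1 / ℚ` (unfolded). [cite: CremonaAlgorithms1997, Table 1] -/
theorem c198c1_eq : c198c1 = ⟨1, -1, 1, -65, 209⟩ := by
  rw [c198c1, baseChange_int_eq]; norm_num
/-- `b₂, b₄, b₆` of `198c1`; `2`-division cubic `= (x − (-9))(4x² + ((-39))x + (93))`. [cite: SilvermanAEC2009, III.1] -/
theorem c198c1_b : c198c1.b₂ = -3 ∧ c198c1.b₄ = -129 ∧ c198c1.b₆ = 837 := by
  rw [c198c1_eq]
  simp only [WeierstrassCurve.b₂, WeierstrassCurve.b₄, WeierstrassCurve.b₆]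
  norm_num
/-- The rational point `(-9, 4)` of order `2` on `198c1`. [cite: CremonaAlgorithms1997, Table 1] -/
theorem c198c1_P : c198c1.toAffine.Equation (-9) 4 ∧
    2 * (4 : ℚ) + c198c1.a₁ * (-9) + c198c1.a₃ = 0 := by
  rw [c198c1_eq, WeierstrassCurve.Affine.equation_iff]; norm_num
/-- **`(-9, 4)` is the ONLY rational point of order `2` on `198c1`** (the cofactor `4x² + ((-39))x + (93)` has non-square discriminant). [cite: SilvermanAEC2009, III.2.3] -/
theorem c198c1_unique : HasUniqueRationalTwoTorsionX c198c1 (-9) := by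
  refine ⟨⟨4, c198c1_P⟩, fun z hz ↦ ?_⟩
  have hc := cubic_eq_zero_of_hasRationalTwoTorsionX hz
  obtain ⟨hb₂, hb₄, hb₆⟩ := c198c1_b
  rw [hb₂, hb₄, hb₆] at hc
  have hfac : (z - (-9)) * (4 * z ^ 2 + (-39) * z + 93) = 0 := by linear_combination hc
  exact eq_of_cubic_factor_of_not_isSquare z hfac (by norm_num)
/-- **`(-9, 4)` is "odd"**: the least real root of the `2`-division cubic. [cite: GreenbergLNM1716, §5 Remark (chunk p0174)] -/
theorem c198c1_odd : TwoTorsionOdd c198c1 (-9) := by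
  intro r hr
  obtain ⟨hb₂, hb₄, hb₆⟩ := c198c1_b
  rw [hb₂, hb₄, hb₆] at hr
  push_cast at hr
  have hfac : (r - (-9)) * (4 * r ^ 2 + (-39) * r + 93) = 0 := by linear_combination hr
  have := le_of_cubic_factor_of_lt r hfac (by norm_num) (by norm_num)
  push_cast; linarith
/-- **`(-9, 4)` is of Greenberg type B** (odd, not ramified at `2`: `-9 ∈ ℤ`). [cite: GreenbergLNM1716, Prop. 5.14 (p. 171)] -/
theorem c198c1_typeAB : (TwoTorsionRamifiedAtTwo ((-9) : ℚ) ∧ ¬ TwoTorsionOdd c198c1 (-9)) ∨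
    (TwoTorsionOdd c198c1 (-9) ∧ ¬ TwoTorsionRamifiedAtTwo ((-9) : ℚ)) :=
  Or.inr ⟨c198c1_odd, by simpa using not_twoTorsionRamifiedAtTwo_intCast (-9)⟩

/-- `2 ∣ #Ẽ(𝔽_ℓ)` for `198c1` at every good odd prime `ℓ` (a rational `2`-torsion point). [cite: SilvermanAEC2009, VII.3.1(b)] -/
theorem two_dvd_reductionPointCount_198c1 {ℓ : ℕ} [Fact ℓ.Prime] (hℓ : 3 ≤ ℓ)
    (hΔ : ¬ (ℓ : ℤ) ∣ (1216512 : ℤ)) : 2 ∣ c198c1.reductionPointCount ℓ :=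
  two_dvd_reductionPointCount_of_hasRationalTwoTorsionX ⟨4, c198c1_P⟩ hℓ
    (by rw [minimalDiscriminantInt_baseChange_int, M198c1_Δ]; exact hΔ)

/-! ## Anchor `342d1` (`N = 342`, split at `2`, type B, `x(P) = -5`) -/

/-- Cremona `342d1` = `[1, -1, 1, -29, 1]` (integer model). [cite: CremonaAlgorithms1997, Table 1] -/
abbrev M342d1 : WeierstrassCurve ℤ := ⟨1, -1, 1, -29, 1⟩
/-- `342d1 / ℚ`. [cite: CremonaAlgorithms1997, Table 1] -/
abbrev c342d1 : WeierstrassCurve ℚ := M342d1.baseChange ℚ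
/-- `Δ(342d1) = 2^2·3^9·19`. [cite: CremonaAlgorithms1997, Table 1] -/
theorem M342d1_Δ : M342d1.Δ = 1495908 := by decide
/-- `c₄(342d1)` (`|c₄| = 3^4·17`). [cite: CremonaAlgorithms1997, Table 1] -/
theorem M342d1_c₄ : M342d1.c₄ = 1377 := by decide
/-- `c₆(342d1)`. [cite: CremonaAlgorithms1997, Table 1] -/
theorem M342d1_c₆ : M342d1.c₆ = 5103 := by decide
/-- **Rizzo's Table II at `342d1`, evaluated in the kernel on the integer invariants** (`3^4 ∥ c₄`, `3^6 ∥ c₆`, `3^9 ∥ Δ`):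
`v₃(N) = 2` (additive, tamely ramified). [cite: Rizzo2003, Table II (p. 4), column v(N)] -/
theorem condExp_342d1 :
    Rizzo.condExpOfInvariants (M342d1.c₄ : ℚ) (M342d1.c₆ : ℚ) (M342d1.Δ : ℚ) = 2 := by
  rw [M342d1_c₄, M342d1_c₆, M342d1_Δ,
    condExpOfInvariants_intCast _ _ _ 4 6 9 (Or.inr (by decide)) (Or.inr (by decide)) (by decide)]
  decide
/-- `342d1` is an elliptic curve. [cite: CremonaAlgorithms1997, Table 1] -/
instance c342d1_isElliptic : c342d1.IsElliptic := by
  rw [WeierstrassCurve.isElliptic_iff, baseChange_int_Δ, M342d1_Δ]; norm_num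
/-- Cremona's model `342d1` is globally minimal (integer criterion at the primes of `gcd(Δ, c₄) = 81`). [cite: SilvermanAEC2009, VII.1 Remark 1.1] -/
instance c342d1_isGloballyMinimal : c342d1.IsGloballyMinimal := by
  rw [c342d1, baseChange_int_eq]
  refine isGloballyMinimal_of_int_criterion 1 (-1) 1 (-29) 1 (int_criterion_of_primeFactors_gcd (by decide) ?_)
  have hg : (Int.gcd (discOf [1, -1, 1, -29, 1]) (c4Of [1, -1, 1, -29, 1])).primeFactors = {3} := by
    rw [show Int.gcd (discOf [1, -1, 1, -29, 1]) (c4Of [1, -1, 1, -29, 1]) = 81 by decide]; simp [Nat.primeFactors]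
  rw [hg]; decide
/-- **`342d1` is multiplicative at `2`** (`2 ∣ Δ`, `2 ∤ c₄`). [cite: SilvermanAEC2009, VII.5 Prop. 5.1(b)] -/
theorem mult_two_342d1 : Mult c342d1 2 := by
  have hgen : Rat.HeightOneSpectrum.natGenerator
      ((Rat.HeightOneSpectrum.primesEquiv (R := ℤ)).symm ⟨2, Nat.prime_two⟩) = 2 :=
    Literature.NumberTheory.EllipticCurves.Rat.natGenerator_primesEquiv_symm ⟨2, Nat.prime_two⟩
  have hm : c342d1.HasMultiplicativeReductionAt
      ((Rat.HeightOneSpectrum.primesEquiv (R := ℤ)).symm ⟨2, Nat.prime_two⟩) := by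
    refine hasMultiplicativeReductionAt_of_valuation_c₄_eq_one (isIntegralAt_baseChange _ M342d1) ?_ ?_
    · rw [baseChange_int_c₄, Literature.NumberTheory.EllipticCurves.Rat.valuation_intCast_eq_one_iff, hgen,
        M342d1_c₄]; decide
    · rw [baseChange_int_Δ, Literature.NumberTheory.EllipticCurves.Rat.valuation_intCast_lt_one_iff, hgen,
        M342d1_Δ]; decide
  exact (hasMultiplicativeReductionAtPrime_iff_hasMultiplicativeReductionAt_holds c342d1
    ⟨2, Nat.prime_two⟩).mpr hm
/-- `342d1 mod 2`. [folklore] -/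
theorem M342d1_mod_two : M342d1.map (Int.castRingHom (ZMod 2)) = ⟨1, 1, 1, 1, 1⟩ := by
  ext <;> decide
/-- **`342d1` is SPLIT multiplicative at `2`** (the node quadratic has the root `0` in `𝔽₂`). [cite: SilvermanAEC2009, VII.5 Prop. 5.1(b)] -/
theorem split_two_342d1 : c342d1.HasSplitMultiplicativeReductionAtPrime 2 := by
  have hint : integralModelInt c342d1 = M342d1 := integralModelInt_baseChange_int M342d1
  have hΔ : ((2 : ℕ) : ℤ) ∣ (integralModelInt c342d1).Δ := by rw [hint, M342d1_Δ]; decide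
  have hc₄ : ¬ ((2 : ℕ) : ℤ) ∣ (integralModelInt c342d1).c₄ := by rw [hint, M342d1_c₄]; decide
  rw [LocalTorsionMult.hasSplitMultiplicativeReductionAtPrime_iff_splits_integralModelInt c342d1 2 hΔ
    hc₄, hint, M342d1_mod_two]
  dsimp only
  rw [sub_eq_add_neg, ← Polynomial.C_neg]
  exact splits_quadratic_F2_of_root (by decide) 0 (by decide)
/-- `342 = 2 * 3 ^ 2 * 19`: factorization exponents. [folklore] -/
theorem nfact_342d1 (p : ℕ) : (342 : ℕ).factorization p =
    (if 2 = p then 1 else 0) + (if 3 = p then 2 else 0) + (if 19 = p then 1 else 0) := by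
  rw [show (342 : ℕ) = 2 * 3 ^ 2 * 19 by norm_num,
    Nat.factorization_mul (by norm_num) (by norm_num),
    Nat.factorization_mul (by norm_num) (by norm_num),
    Nat.factorization_pow,
    Nat.Prime.factorization (by norm_num : Nat.Prime 2),
    Nat.Prime.factorization (by norm_num : Nat.Prime 3),
    Nat.Prime.factorization (by norm_num : Nat.Prime 19)]
  simp only [Finsupp.coe_add, Finsupp.coe_smul, Pi.add_apply, Pi.smul_apply, Finsupp.single_apply,
    smul_eq_mul]
  split_ifs <;> omega

/-- The conductor exponents of `342d1`: `1` at the multiplicative primes, `2` at the additive ones (at `3`: Rizzo's Table II; at `ℓ ≥ 5`: ATAEC IV.10.2), `0` else.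
[cite: Silverman1994, IV.10.2] [cite: Rizzo2003, Table II (p. 4), column v(N)] -/
theorem factorization_conductorNorm_342d1 (p : ℕ) (hp : p.Prime) :
    (c342d1.conductorNorm ℤ).factorization p = (342 : ℕ).factorization p := by
  have key : (c342d1.conductorNorm ℤ).factorization p =
      c342d1.conductorExponent ((Rat.HeightOneSpectrum.primesEquiv (R := ℤ)).symm ⟨p, hp⟩) :=
    factorization_conductorNorm_primesEquiv_symm c342d1 ⟨p, hp⟩
  rw [key, nfact_342d1]
  by_cases h2 : 2 = p
  · subst h2
    rw [conductorExponent_baseChange_int_eq_one M342d1 hp (by rw [M342d1_Δ]; decide)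
      (by rw [M342d1_c₄]; decide)]
    norm_num
  by_cases h3 : 3 = p
  · subst h3
    rw [show ((Rat.HeightOneSpectrum.primesEquiv (R := ℤ)).symm ⟨3, hp⟩) =
        (Rat.HeightOneSpectrum.primesEquiv (R := ℤ)).symm ⟨3, Nat.prime_three⟩ from rfl,
      conductorExponent_baseChange_int_three M342d1 condExp_342d1]
    norm_num
  by_cases h19 : 19 = p
  · subst h19
    rw [conductorExponent_baseChange_int_eq_one M342d1 hp (by rw [M342d1_Δ]; decide)
      (by rw [M342d1_c₄]; decide)]
    norm_num
  rw [if_neg h2, if_neg h3, if_neg h19]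
  refine conductorExponent_baseChange_int_eq_zero M342d1 hp fun hd ↦ ?_
  rw [M342d1_Δ, show (1495908 : ℤ) = 2 ^ 2 * 3 ^ 9 * 19 by norm_num] at hd
  have hp' : Prime (p : ℤ) := Nat.prime_iff_prime_int.mp hp
  rcases hp'.dvd_or_dvd hd with hd | h_19; swap
  · exact h19 ((Nat.prime_dvd_prime_iff_eq hp (by norm_num : Nat.Prime 19)).mp (by exact_mod_cast h_19)).symm
  rcases hp'.dvd_or_dvd hd with hd | h_3; swap
  · exact h3 ((Nat.prime_dvd_prime_iff_eq hp (by norm_num : Nat.Prime 3)).mp (by exact_mod_cast hp'.dvd_of_dvd_pow h_3)).symm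
  exact h2 ((Nat.prime_dvd_prime_iff_eq hp (by norm_num : Nat.Prime 2)).mp (by exact_mod_cast hp'.dvd_of_dvd_pow hd)).symm

/-- **`N(342d1) = 342`.** [cite: CremonaAlgorithms1997, Table 1] -/
theorem conductorNorm_342d1 : c342d1.conductorNorm ℤ = 342 := by
  refine Nat.eq_of_factorization_eq (c342d1.conductorNorm_pos_holds).ne' (by norm_num) fun p ↦ ?_
  by_cases hp : p.Prime; · exact factorization_conductorNorm_342d1 p hp
  rw [Nat.factorization_eq_zero_of_not_prime _ hp, Nat.factorization_eq_zero_of_not_prime _ hp]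

/-- The coefficients of `342d1 / ℚ` (unfolded). [cite: CremonaAlgorithms1997, Table 1] -/
theorem c342d1_eq : c342d1 = ⟨1, -1, 1, -29, 1⟩ := by
  rw [c342d1, baseChange_int_eq]; norm_num
/-- `b₂, b₄, b₆` of `342d1`; `2`-division cubic `= (x − (-5))(4x² + ((-23))x + (1))`. [cite: SilvermanAEC2009, III.1] -/
theorem c342d1_b : c342d1.b₂ = -3 ∧ c342d1.b₄ = -57 ∧ c342d1.b₆ = 5 := by
  rw [c342d1_eq]
  simp only [WeierstrassCurve.b₂, WeierstrassCurve.b₄, WeierstrassCurve.b₆]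
  norm_num
/-- The rational point `(-5, 2)` of order `2` on `342d1`. [cite: CremonaAlgorithms1997, Table 1] -/
theorem c342d1_P : c342d1.toAffine.Equation (-5) 2 ∧
    2 * (2 : ℚ) + c342d1.a₁ * (-5) + c342d1.a₃ = 0 := by
  rw [c342d1_eq, WeierstrassCurve.Affine.equation_iff]; norm_num
/-- **`(-5, 2)` is the ONLY rational point of order `2` on `342d1`** (the cofactor `4x² + ((-23))x + (1)` has non-square discriminant). [cite: SilvermanAEC2009, III.2.3] -/
theorem c342d1_unique : HasUniqueRationalTwoTorsionX c342d1 (-5) := by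
  refine ⟨⟨2, c342d1_P⟩, fun z hz ↦ ?_⟩
  have hc := cubic_eq_zero_of_hasRationalTwoTorsionX hz
  obtain ⟨hb₂, hb₄, hb₆⟩ := c342d1_b
  rw [hb₂, hb₄, hb₆] at hc
  have hfac : (z - (-5)) * (4 * z ^ 2 + (-23) * z + 1) = 0 := by linear_combination hc
  exact eq_of_cubic_factor_of_not_isSquare z hfac (by norm_num)
/-- **`(-5, 2)` is "odd"**: the least real root of the `2`-division cubic. [cite: GreenbergLNM1716, §5 Remark (chunk p0174)] -/
theorem c342d1_odd : TwoTorsionOdd c342d1 (-5) := by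
  intro r hr
  obtain ⟨hb₂, hb₄, hb₆⟩ := c342d1_b
  rw [hb₂, hb₄, hb₆] at hr
  push_cast at hr
  have hfac : (r - (-5)) * (4 * r ^ 2 + (-23) * r + 1) = 0 := by linear_combination hr
  have := le_of_cubic_factor_of_lt r hfac (by norm_num) (by norm_num)
  push_cast; linarith
/-- **`(-5, 2)` is of Greenberg type B** (odd, not ramified at `2`: `-5 ∈ ℤ`). [cite: GreenbergLNM1716, Prop. 5.14 (p. 171)] -/
theorem c342d1_typeAB : (TwoTorsionRamifiedAtTwo ((-5) : ℚ) ∧ ¬ TwoTorsionOdd c342d1 (-5)) ∨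
    (TwoTorsionOdd c342d1 (-5) ∧ ¬ TwoTorsionRamifiedAtTwo ((-5) : ℚ)) :=
  Or.inr ⟨c342d1_odd, by simpa using not_twoTorsionRamifiedAtTwo_intCast (-5)⟩

/-- `2 ∣ #Ẽ(𝔽_ℓ)` for `342d1` at every good odd prime `ℓ` (a rational `2`-torsion point). [cite: SilvermanAEC2009, VII.3.1(b)] -/
theorem two_dvd_reductionPointCount_342d1 {ℓ : ℕ} [Fact ℓ.Prime] (hℓ : 3 ≤ ℓ)
    (hΔ : ¬ (ℓ : ℤ) ∣ (1495908 : ℤ)) : 2 ∣ c342d1.reductionPointCount ℓ :=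
  two_dvd_reductionPointCount_of_hasRationalTwoTorsionX ⟨2, c342d1_P⟩ hℓ
    (by rw [minimalDiscriminantInt_baseChange_int, M342d1_Δ]; exact hΔ)

end Summit.BirchSwinnertonDyer.Rank1Residual.X5.Instances
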